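import Literature.Geometry.Lorentzian.AsymptoticallyFlatCompletenessWeak
import Literature.Geometry.Lorentzian.AFEndChartEmbedding
import HarnessLib

/-!
# The lapse of a translational Killing initial datum is bounded on an asymptotically flat,
# one-ended data manifold

In the proof of the rigid positive energy theorem (Beig–Chruściel, J. Math. Phys. 37 (1996),
Thm. 4.1, `m = 0`) the developed hypersurface `f(Σ) ⊆ (ℝ⁴, η)` is a Cauchy hypersurface because
it is UNIFORMLY spacelike, and by `SpacelikeGraphSlope.lean` (`‖∇u‖² = 1 − N₀⁻²`) this is the
boundedness on `Σ` of the lapse `N₀` of the timelike translational Killing initial datum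
`(N₀, Y₀)`. Beig–Chruściel obtain it from the asymptotics of Killing initial data on
asymptotically flat ends (§2, Prop. 2.2: for a translational KID `N − A⁰ = O_k(r^{-α})`,
`Yⁱ − Aⁱ = O_k(r^{-α})`). This file proves the boundedness clause by a shortcut available for
the KIDs of the rigidity theorem, which satisfy the Gram identity `−N₀² + h(Y₀, Y₀) = −1`:
the lapse equation `dN = −k(·, Y)` and `h(Y, Y) ≤ N²` give `|d log N| ≤ |k|_h`, and
`|k| = O(r^{-1-α})` is integrable along the coordinate rays of the end.

* `AFEnd.mfderiv_dataChartExt_mfderiv_coord` — `dΦₑ ∘ dcoord = id` on the end (chart calculus);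
* `AFEnd.norm_fderiv_lapse_comp_dataChartExt_le` — beyond the radius of norm comparison,
  `‖D(N ∘ Φₑ)(z)‖ ≤ √2 ‖k_ij(z)‖ N(Φₑ z)`;
* `AFEnd.le_mul_exp_of_abs_deriv_le` — Grönwall along a ray: `|g'| ≤ c s^{-α-1} g` on `[R₂, ∞)`
  ⟹ `g(S) ≤ g(R₂) exp(c R₂^{-α}/α)`;
* `AFEnd.exists_forall_lapse_le` — **main result**: on a manifold with an asymptotically flat
  end of order `α > 0` which is its sole end, a differentiable `N > 0` with `dN(v) = −k(v, Y)`
  and `h(Y, Y) ≤ N²` is bounded above.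

Theorems only; no definitions, no named facts.

## References

* R. Beig, P. T. Chruściel, *Killing vectors in asymptotically flat space-times. I.
  Asymptotically translational Killing vectors and the rigid positive energy theorem*, J. Math.
  Phys. 37 (1996) 1939–1961, arXiv:gr-qc/9510015: §2, Prop. 2.2; §4, proof of Thm. 4.1.
  [BeigChrusciel1996]
* R. Bartnik, *The mass of an asymptotically flat manifold*, CPAM 39 (1986), §1 (structure of
  infinity, the chart of the end). [Bartnik1986]
-/

noncomputable section

open Bundle Set Function Filter Manifold Asymptotics Bornology
open scoped Manifold ContDiff Topology NNReal

namespace Literature.Geometry.Lorentzian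

namespace AFEnd

variable {X : Type} [TopologicalSpace X] [ChartedSpace E3 X] [IsManifold (𝓡 3) ∞ X]
  (e : AFEnd X) (D : InitialDataSet (𝓡 3) X)

/-! ### Chart calculus: `dΦₑ ∘ dcoord = id` on the end -/

omit [IsManifold (𝓡 3) ∞ X] in
/-- **`dΦₑ_{coord q} (dcoord_q v) = v`** on the end (`Φₑ ∘ coord = id` near `q ∈ U`, `U` open);
companion of `mfderiv_coord_mfderiv_dataChartExt`. [cite: Bartnik1986, §1] -/
theorem mfderiv_dataChartExt_mfderiv_coord {q : X} (hq : q ∈ e.U) (v : TangentSpace (𝓡 3) q) :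
    mfderiv 𝓘(ℝ, E3) (𝓡 3) e.dataChartExt (e.coord q) (mfderiv (𝓡 3) 𝓘(ℝ, E3) e.coord q v) =
      v := by
  have hev : (e.dataChartExt ∘ e.coord) =ᶠ[𝓝 q] id := by
    filter_upwards [e.U.2.mem_nhds hq] with q' hq'
    exact e.dataChartExt_coord_of_mem hq'
  have hc : MDifferentiableAt (𝓡 3) 𝓘(ℝ, E3) e.coord q :=
    (e.contMDiffAt_coord hq).mdifferentiableAt (by simp)
  have hd : MDifferentiableAt 𝓘(ℝ, E3) (𝓡 3) e.dataChartExt (e.coord q) :=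
    (e.contMDiffAt_dataChartExt (e.lt_norm_coord hq)).mdifferentiableAt (by simp)
  have h1 : mfderiv (𝓡 3) (𝓡 3) (e.dataChartExt ∘ e.coord) q =
      ContinuousLinearMap.id ℝ (TangentSpace (𝓡 3) q) := by
    rw [hev.mfderiv_eq, mfderiv_id]
  have h2 := mfderiv_comp q hd hc
  exact DFunLike.congr_fun (h2.symm.trans h1) v

/-! ### The derivative of the lapse read in the chart -/

variable {e D}

/-- **The chart derivative of the lapse is controlled by `k` and the lapse itself.** Let
`(N, Y)` satisfy the lapse equation `dN(v) = −k(v, Y)` of a Killing initial datum and the Gram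
inequality `h(Y, Y) ≤ N²` (for the timelike translational KID of the rigidity theorem,
`−N₀² + h(Y₀, Y₀) = −1`), `N > 0`, and let `R₁ > R` be a radius beyond which the coordinate norm is
dominated by the metric, `‖w‖² ≤ 2 h_ij wⁱ wʲ` (`exists_radius_norm_sq_le`). Then beyond `R₁` the
derivative of `N ∘ Φₑ` (`Φₑ = dataChartExt`, the total inverse chart) satisfies
`‖D(N ∘ Φₑ)(z)‖ ≤ √2 ‖k_ij(z)‖ N(Φₑ z)`: indeed `D(N ∘ Φₑ)(z) w = −k(dΦₑ w, Y) = −k_ij(z) wⁱ Ỹʲ`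
with `Ỹ = dcoord(Y)` the chart components of `Y`, and `‖Ỹ‖² ≤ 2 h(Y, Y) ≤ 2 N²`. This is the
differential inequality behind the boundedness of asymptotically translational Killing lapses,
Beig–Chruściel 1996, §2, Prop. 2.2 (case `Λ = 0`: `N − A⁰ = O(r^{-α})`).
[cite: BeigChrusciel1996, §2, Prop. 2.2] -/
theorem norm_fderiv_lapse_comp_dataChartExt_le {N : X → ℝ} {Y : Π x : X, TangentSpace (𝓡 3) x}
    (hN : MDifferentiable (𝓡 3) 𝓘(ℝ, ℝ) N)
    (hdN : ∀ (x : X) (v : TangentSpace (𝓡 3) x), mvfderiv (𝓡 3) N x v = -(D.k x v (Y x)))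
    (hYN : ∀ x, D.h.inner x (Y x) (Y x) ≤ N x ^ 2) (hN0 : ∀ x, 0 < N x) {R₁ : ℝ} (hR₁ : e.R < R₁)
    (hnorm : ∀ y : E3, R₁ ≤ ‖y‖ → ∀ w : E3, ‖w‖ ^ 2 ≤ 2 * hCoeff e D y w w) {z : E3}
    (hz : R₁ ≤ ‖z‖) :
    DifferentiableAt ℝ (N ∘ e.dataChartExt) z ∧
      ‖fderiv ℝ (N ∘ e.dataChartExt) z‖ ≤ Real.sqrt 2 * ‖kCoeff e D z‖ * N (e.dataChartExt z) := by
  have hzR : e.R < ‖z‖ := lt_of_lt_of_le hR₁ hz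
  set q := e.dataChartExt z with hq_def
  have hq : q ∈ e.U := e.dataChartExt_mem hzR
  have hΦd : MDifferentiableAt 𝓘(ℝ, E3) (𝓡 3) e.dataChartExt z :=
    (e.contMDiffAt_dataChartExt hzR).mdifferentiableAt (by simp)
  have hcomp : MDifferentiableAt 𝓘(ℝ, E3) 𝓘(ℝ, ℝ) (N ∘ e.dataChartExt) z := (hN q).comp z hΦd
  have hdiff : DifferentiableAt ℝ (N ∘ e.dataChartExt) z :=
    mdifferentiableAt_iff_differentiableAt.1 hcomp
  refine ⟨hdiff, ?_⟩
  -- the chart components `Ỹ` of `Y q`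
  set A := mfderiv 𝓘(ℝ, E3) (𝓡 3) e.dataChartExt z with hA_def
  set Yc : E3 := mfderiv (𝓡 3) 𝓘(ℝ, E3) e.coord q (Y q) with hYc_def
  have hcz : e.coord q = z := e.coord_dataChartExt_of_lt hzR
  have hAY : A Yc = Y q := by
    have key : ∀ z' : E3, z' = e.coord q →
        mfderiv 𝓘(ℝ, E3) (𝓡 3) e.dataChartExt z' Yc = Y q := by
      rintro z' rfl
      exact e.mfderiv_dataChartExt_mfderiv_coord hq (Y q)
    exact key z hcz.symm
  -- the derivative in the direction `w` is `−k_ij(z) wⁱ Ỹʲ`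
  have hderiv : ∀ w : E3, fderiv ℝ (N ∘ e.dataChartExt) z w = -(kCoeff e D z w Yc) := by
    intro w
    have h2 : mvfderiv 𝓘(ℝ, E3) (N ∘ e.dataChartExt) z w = mvfderiv (𝓡 3) N q (A w) := by
      show mfderiv 𝓘(ℝ, E3) 𝓘(ℝ, ℝ) (N ∘ e.dataChartExt) z w = mfderiv (𝓡 3) 𝓘(ℝ, ℝ) N q (A w)
      rw [mfderiv_comp z (hN q) hΦd]
      rfl
    have h1 : fderiv ℝ (N ∘ e.dataChartExt) z w = mvfderiv (𝓡 3) N q (A w) := by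
      rw [← h2]
      show fderiv ℝ (N ∘ e.dataChartExt) z w =
        mfderiv 𝓘(ℝ, E3) 𝓘(ℝ, ℝ) (N ∘ e.dataChartExt) z w
      rw [mfderiv_eq_fderiv]
      rfl
    rw [h1, hdN q (A w), e.kCoeff_apply_eq_dataChartExt D hzR w Yc]
    show -(D.k q (A w) (Y q)) = -(D.k q (A w) (A Yc))
    rw [hAY]
  -- `‖Ỹ‖ ≤ √2 N q`
  have hYc2 : ‖Yc‖ ^ 2 ≤ 2 * N q ^ 2 := by
    have h1 := hnorm z hz Yc
    rw [e.hCoeff_apply_eq_dataChartExt D hzR Yc Yc] at h1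
    have h2 : D.h.inner q (A Yc) (A Yc) ≤ N q ^ 2 := by rw [hAY]; exact hYN q
    linarith
  have hYc : ‖Yc‖ ≤ Real.sqrt 2 * N q := by
    have h2 : (Real.sqrt 2 * N q) ^ 2 = 2 * N q ^ 2 := by
      rw [mul_pow, Real.sq_sqrt (by norm_num : (0 : ℝ) ≤ 2)]
    refine (pow_le_pow_iff_left₀ (norm_nonneg _) (by positivity [hN0 q]) two_ne_zero).1 ?_
    rw [h2]
    exact hYc2
  -- operator norm bound
  have hop : ‖fderiv ℝ (N ∘ e.dataChartExt) z‖ ≤ ‖kCoeff e D z‖ * ‖Yc‖ := by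
    refine ContinuousLinearMap.opNorm_le_bound _ (by positivity) fun w ↦ ?_
    rw [hderiv w, norm_neg]
    calc ‖kCoeff e D z w Yc‖ ≤ ‖kCoeff e D z‖ * ‖w‖ * ‖Yc‖ := (kCoeff e D z).le_opNorm₂ w Yc
      _ = ‖kCoeff e D z‖ * ‖Yc‖ * ‖w‖ := by ring
  calc ‖fderiv ℝ (N ∘ e.dataChartExt) z‖ ≤ ‖kCoeff e D z‖ * ‖Yc‖ := hop
    _ ≤ ‖kCoeff e D z‖ * (Real.sqrt 2 * N q) := by gcongr
    _ = Real.sqrt 2 * ‖kCoeff e D z‖ * N q := by ring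

/-! ### Integration along coordinate rays -/

/-- **Grönwall along rays.** Let `g : ℝ → ℝ` be positive and differentiable on `(R, ∞) ⊇ [R₂, ∞)`
with `|g'(s)| ≤ c s^{-α-1} g(s)` for `s ≥ R₂ > 0` (`α > 0`, `c ≥ 0`). Then
`g(S) ≤ g(R₂) exp(c R₂^{-α} / α)` for all `S ≥ R₂`: the function `g(s) exp((c/α) s^{-α})` is
non-increasing. [folklore] -/
theorem le_mul_exp_of_abs_deriv_le {g : ℝ → ℝ} {R₂ α c : ℝ} (hR₂ : 0 < R₂) (hα : 0 < α)
    (hc : 0 ≤ c) (hg : ∀ s, R₂ ≤ s → DifferentiableAt ℝ g s) (hpos : ∀ s, R₂ ≤ s → 0 < g s)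
    (hle : ∀ s, R₂ ≤ s → |deriv g s| ≤ c * s ^ (-α - 1) * g s) {S : ℝ} (hS : R₂ ≤ S) :
    g S ≤ g R₂ * Real.exp (c / α * R₂ ^ (-α)) := by
  set φ : ℝ → ℝ := fun s ↦ Real.exp (c / α * s ^ (-α)) with hφ
  set F : ℝ → ℝ := fun s ↦ g s * φ s with hF
  have hφd : ∀ s, 0 < s → HasDerivAt φ (Real.exp (c / α * s ^ (-α)) *
      (c / α * (-α * s ^ (-α - 1)))) s := fun s hs ↦
    ((Real.hasDerivAt_rpow_const (p := -α) (Or.inl hs.ne')).const_mul (c / α)).exp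
  have hFd : ∀ s, R₂ ≤ s → HasDerivAt F (deriv g s * φ s +
      g s * (Real.exp (c / α * s ^ (-α)) * (c / α * (-α * s ^ (-α - 1))))) s := fun s hs ↦
    (hg s hs).hasDerivAt.mul (hφd s (lt_of_lt_of_le hR₂ hs))
  have hanti : AntitoneOn F (Ici R₂) := by
    refine antitoneOn_of_deriv_nonpos (convex_Ici R₂) ?_ ?_ ?_
    · exact fun s hs ↦ (hFd s hs).continuousAt.continuousWithinAt
    · rw [interior_Ici]
      exact fun s hs ↦ (hFd s (le_of_lt hs)).differentiableAt.differentiableWithinAt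
    · rw [interior_Ici]
      intro s hs
      have hs' : R₂ ≤ s := le_of_lt hs
      have hs0 : 0 < s := lt_of_lt_of_le hR₂ hs'
      rw [(hFd s hs').deriv]
      have hφs : φ s = Real.exp (c / α * s ^ (-α)) := rfl
      rw [hφs]
      have hkey : deriv g s * Real.exp (c / α * s ^ (-α)) +
          g s * (Real.exp (c / α * s ^ (-α)) * (c / α * (-α * s ^ (-α - 1)))) =
          Real.exp (c / α * s ^ (-α)) * (deriv g s - c * s ^ (-α - 1) * g s) := by
        field_simp
        ring
      rw [hkey]
      refine mul_nonpos_of_nonneg_of_nonpos (Real.exp_nonneg _) ?_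
      linarith [(abs_le.1 (hle s hs')).2]
  have h1 : F S ≤ F R₂ := hanti (mem_Ici.2 le_rfl) (mem_Ici.2 hS) hS
  have hφS : 1 ≤ φ S :=
    Real.one_le_exp_iff.2 (mul_nonneg (div_nonneg hc hα.le)
      (Real.rpow_nonneg (hR₂.le.trans hS) _))
  have hgS : 0 < g S := hpos S hS
  calc g S ≤ g S * φ S := le_mul_of_one_le_right hgS.le hφS
    _ = F S := rfl
    _ ≤ F R₂ := h1
    _ = g R₂ * Real.exp (c / α * R₂ ^ (-α)) := rfl

/-! ### Boundedness of the lapse -/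

-- the operator norm on `E3 →L[ℝ] E3 →L[ℝ] ℝ` is slow to synthesize through `PiLp`
set_option synthInstance.maxHeartbeats 80000 in
/-- **The lapse of a translational Killing initial datum is bounded.** Let `(X, h, k)` carry an
asymptotically flat end `e` of order `α > 0` which is its only end (`X ∖ far` compact), and let
`(N, Y)` be a differentiable function and a (not necessarily continuous) vector field with the
lapse equation `dN(v) = −k(v, Y)`, the Gram inequality `h(Y, Y) ≤ N²` and `N > 0` — as the
timelike member `(N₀, Y₀)` of the translational KIDs of the rigidity theorem, for which
`−N₀² + h(Y₀, Y₀) = η₀₀ = −1`. Then `N ≤ B` on `X` for some constant `B`.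

Proof: on the compact complement of the far region `N` is bounded by continuity; a point of the
far region is the endpoint `Φₑ(S ŷ)` of the coordinate ray `s ↦ Φₑ(s ŷ)`, `R₂ ≤ s ≤ S`, along
which `g(s) = N(Φₑ(s ŷ))` satisfies `|g'| ≤ √2 ‖k_ij‖ g ≤ √2 C s^{-1-α} g`
(`norm_fderiv_lapse_comp_dataChartExt_le` and `k_ij = O(r^{-1-α})`), whence
`g(S) ≤ g(R₂) e^{√2 C R₂^{-α}/α}` (`le_mul_exp_of_abs_deriv_le`), and `g(R₂)` is a value on the
compact part. This is the boundedness clause of Beig–Chruściel 1996, §2, Prop. 2.2 for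
translational KIDs (`Λ_{μν} = 0`: `N − A⁰ = O_k(r^{-α})`), obtained here by the Gram identity
instead of the full asymptotic expansion; it is what makes the developed hypersurface of the
proof of Thm. 4.1 uniformly spacelike (`SpacelikeGraphSlope.lean`,
`SpacetimePositiveMassRigidityReductionBounded.lean`).
[cite: BeigChrusciel1996, §2, Prop. 2.2 and §4, proof of Thm. 4.1] -/
theorem exists_forall_lapse_le {α : ℝ} (hα : 0 < α) (haf : e.IsAsymptoticallyFlat D α)
    (hsole : e.IsSoleEnd) {N : X → ℝ} {Y : Π x : X, TangentSpace (𝓡 3) x}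
    (hN : MDifferentiable (𝓡 3) 𝓘(ℝ, ℝ) N)
    (hdN : ∀ (x : X) (v : TangentSpace (𝓡 3) x), mvfderiv (𝓡 3) N x v = -(D.k x v (Y x)))
    (hYN : ∀ x, D.h.inner x (Y x) (Y x) ≤ N x ^ 2) (hN0 : ∀ x, 0 < N x) :
    ∃ B : ℝ, ∀ x, N x ≤ B := by
  -- radius of norm comparison
  obtain ⟨R₁, hR₁, hR₁0, hnorm⟩ := exists_radius_norm_sq_le (le_refl (0 : ℝ))
    (haf.isStronglyAsymptoticallyFlatWith_zero (β := 0) (γ := α) hα (by linarith))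
  -- radius and constant of the decay of `k`
  obtain ⟨C, hC0, hC⟩ := (haf.2 0 zero_le_one).exists_nonneg
  obtain ⟨r, -, hr⟩ := (Filter.hasBasis_cobounded_norm (E := E3)).eventually_iff.1 hC.bound
  have hk : ∀ z : E3, r ≤ ‖z‖ → ‖kCoeff e D z‖ ≤ C * ‖z‖ ^ (-α - 1) := by
    intro z hz
    have h := hr hz
    rw [norm_iteratedFDeriv_zero, norm_norm, Nat.cast_zero, sub_zero,
      Real.norm_of_nonneg (Real.rpow_nonneg (norm_nonneg _) _)] at h
    exact h
  set R₂ : ℝ := max R₁ r with hR₂_def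
  have hR₂1 : R₁ ≤ R₂ := le_max_left _ _
  have hR₂r : r ≤ R₂ := le_max_right _ _
  have hR₂0 : 0 < R₂ := lt_of_lt_of_le hR₁0 hR₂1
  have hR₂R : e.R < R₂ := lt_of_lt_of_le hR₁ hR₂1
  -- bound on the compact part
  obtain ⟨K, hK, hKsub⟩ := exists_isCompact_compl_far_subset hsole R₂
  obtain ⟨M₁, hM₁⟩ := (hK.bddAbove_image hN.continuous.continuousOn)
  have hM : ∀ x, x ∉ e.far R₂ → N x ≤ M₁ := fun x hx ↦
    hM₁ (mem_image_of_mem N (hKsub hx))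
  set B : ℝ := max M₁ 0 * Real.exp (Real.sqrt 2 * C / α * R₂ ^ (-α)) with hB_def
  have hB1 : max M₁ 0 ≤ B := le_mul_of_one_le_right (le_max_right _ _)
    (Real.one_le_exp_iff.2 (mul_nonneg (div_nonneg (by positivity) hα.le)
      (Real.rpow_nonneg hR₂0.le _)))
  refine ⟨B, fun x ↦ ?_⟩
  by_cases hx : x ∈ e.far R₂
  swap
  · exact ((hM x hx).trans (le_max_left _ _)).trans hB1
  -- a far point: integrate along the coordinate ray
  obtain ⟨hxU, hxR⟩ := e.mem_far_iff_coord.1 hx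
  set z : E3 := e.coord x with hz_def
  set S : ℝ := ‖z‖ with hS_def
  have hS0 : 0 < S := hR₂0.trans hxR
  set yhat : E3 := S⁻¹ • z with hyhat
  have hyhat1 : ‖yhat‖ = 1 := by
    rw [hyhat, norm_smul, norm_inv, Real.norm_of_nonneg hS0.le, inv_mul_cancel₀ hS0.ne']
  have hnsy : ∀ s, 0 ≤ s → ‖s • yhat‖ = s := fun s hs ↦ by
    rw [norm_smul, hyhat1, mul_one, Real.norm_of_nonneg hs]
  set g : ℝ → ℝ := fun s ↦ N (e.dataChartExt (s • yhat)) with hg_def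
  -- derivative of `g` for `s ≥ R₂`
  have hgd : ∀ s, R₂ ≤ s → HasDerivAt g (fderiv ℝ (N ∘ e.dataChartExt) (s • yhat) yhat) s := by
    intro s hs
    have hs1 : R₁ ≤ ‖s • yhat‖ := by rw [hnsy s (hR₂0.le.trans hs)]; exact hR₂1.trans hs
    have hd := (norm_fderiv_lapse_comp_dataChartExt_le hN hdN hYN hN0 hR₁ hnorm hs1).1
    have h2 : HasDerivAt (fun s : ℝ ↦ s • yhat) yhat s := by
      simpa using (hasDerivAt_id s).smul_const yhat
    exact hd.hasFDerivAt.comp_hasDerivAt s h2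
  have hgle : ∀ s, R₂ ≤ s → |deriv g s| ≤ Real.sqrt 2 * C * s ^ (-α - 1) * g s := by
    intro s hs
    have hs0 : 0 ≤ s := hR₂0.le.trans hs
    have hs1 : R₁ ≤ ‖s • yhat‖ := by rw [hnsy s hs0]; exact hR₂1.trans hs
    obtain ⟨-, hb⟩ := norm_fderiv_lapse_comp_dataChartExt_le hN hdN hYN hN0 hR₁ hnorm hs1
    rw [(hgd s hs).deriv, ← Real.norm_eq_abs]
    have hks := hk (s • yhat) (by rw [hnsy s hs0]; exact hR₂r.trans hs)
    rw [hnsy s hs0] at hks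
    have hgs : 0 ≤ g s := (hN0 _).le
    calc ‖fderiv ℝ (N ∘ e.dataChartExt) (s • yhat) yhat‖
        ≤ ‖fderiv ℝ (N ∘ e.dataChartExt) (s • yhat)‖ * ‖yhat‖ :=
          ContinuousLinearMap.le_opNorm _ _
      _ = ‖fderiv ℝ (N ∘ e.dataChartExt) (s • yhat)‖ := by rw [hyhat1, mul_one]
      _ ≤ Real.sqrt 2 * ‖kCoeff e D (s • yhat)‖ * N (e.dataChartExt (s • yhat)) := hb
      _ ≤ Real.sqrt 2 * (C * s ^ (-α - 1)) * N (e.dataChartExt (s • yhat)) := by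
          gcongr
      _ = Real.sqrt 2 * C * s ^ (-α - 1) * g s := by rw [hg_def]; ring
  have hray := le_mul_exp_of_abs_deriv_le (g := g) hR₂0 hα (by positivity)
    (fun s hs ↦ (hgd s hs).differentiableAt) (fun s _ ↦ hN0 _) hgle hxR.le
  -- `g S = N x`, `g R₂ ≤ M₁`
  have hgS : g S = N x := by
    show N (e.dataChartExt (S • yhat)) = N x
    rw [hyhat, smul_smul, mul_inv_cancel₀ hS0.ne', one_smul, hz_def,
      e.dataChartExt_coord_of_mem hxU]
  have hgR : g R₂ ≤ max M₁ 0 := by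
    refine (hM _ fun hfar ↦ ?_).trans (le_max_left _ _)
    have hR : e.R < ‖R₂ • yhat‖ := by rw [hnsy R₂ hR₂0.le]; exact hR₂R
    have := (e.dataChartExt_mem_far_iff hR).1 hfar
    rw [hnsy R₂ hR₂0.le] at this
    exact lt_irrefl _ this
  rw [← hgS]
  calc g S ≤ g R₂ * Real.exp (Real.sqrt 2 * C / α * R₂ ^ (-α)) := hray
    _ ≤ max M₁ 0 * Real.exp (Real.sqrt 2 * C / α * R₂ ^ (-α)) := by
        gcongr
    _ = B := rfl

end AFEnd

end Literature.Geometry.Lorentzian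

end
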